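import Summits.BirchSwinnertonDyer.BirchSwinnertonDyer.Theorems.KolyvaginRoadThreeMethod2EvenLevels
import Summits.BirchSwinnertonDyer.BirchSwinnertonDyer.Theorems.KolyvaginRoadThreeMethod2StubA
import HarnessLib

/-!
# Route `KolyvaginRoadThree`, crux `ZhangSharpFrameAtThreeHL` (item stmt-BirchSwinnertonDyer-19574), stub S2-KS
# `stub_levelKolyvaginSystemsAtThree`: THE BIPARTITE DICTIONARY AT `p = 3` — a `Method2.LevelKolyvaginSystem` from ONE
# mod-3 bipartite datum (classes at EVEN good levels, values at ODD good levels, the two one-directional reciprocity laws)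
# and the rank-0 ANCHOR at odd good levels; rank lowering (A1) discharged by the landed stub A
# (cell `bsd-stepL`, seat `bsd-stepL-zhang3-w2` g0; `--supports stmt-BirchSwinnertonDyer-19574`, helper; the `p = 3` ∕ GOOD-level
# port of the `p ≥ 5` dictionary `AdditiveKolyvaginRoadLevelSystemsEvenLevels` §2 + `…LevelSystemsOfBipartite` of KS′ 21396)

WHY. The registered residual stub S2-KS of the METHOD line v3.2 (`Cruxes/ZhangSharpFrameAtThreeHL/Lines/method2.lean`,
skeleton 2e396e49c718) asks `Nonempty (Method2.LevelKolyvaginSystem W K Dt β ι c)` at every Hoffstein–Luo A1 frame. koly g16's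
`Method2EvenLevels.nonempty_levelKolyvaginSystem_of_evenLevels` (LANDED) showed that the structure owes classes only at EVEN good
levels (odd = definite levels are filled by `0`). Two of its fields are NOT local axioms of W. Zhang's classes but THEOREMS of
[Z14] about them, and in print each is the composite of more primitive one-directional statements through the DEFINITE (odd) levels:
* `transport` ((A2), Zhang Thm. 4.3 in contrapositive form: a class two levels up detected above `q₂` ⟹ a non-zero class below) is
  the composite of the two Bertolini–Darmon reciprocity halves through the value `λ(m, n∪q₁) ∈ 𝔽₃` at the ODD level `n ∪ q₁`:
  (B⇒) `κ₀(m, n∪q₁∪q₂)` NOT locally trivial above the LEVEL prime `q₂ ⟹ λ(m, n∪q₁) ≠ 0` (ordinary ∕ toric part at a level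
  prime = the value one level down; BD05 Thm. 4.1, Zhang (4.3)–(4.5) second half), then (A⇐) `λ(m, n∪q₁) ≠ 0 ⟹ κ₀(m, n)` NOT
  locally trivial above the NEW prime `q₁` (finite part at a new prime = the value one level up; BD05 Thm. 4.2, Zhang (4.8));
* `baseCase` ((A5), Zhang Thm. 7.2 at every even good level of canonical rank one: `κ₀(∅, n) ≠ 0`) is, by Zhang's own proof
  (pp. 232–233), (A1) rank lowering at ONE new good prime `q` (the line `Sel_n^μ = 𝔽₃·x` dies in `Sel_{n∪q}^μ`, the other sign
  unchanged, so the odd level `n ∪ q` has total canonical rank ZERO) + the rank-0 ANCHOR (γ) at odd good levels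
  (`dim Sel_{n'}⁺ + dim Sel_{n'}⁻ = 0 ⟹ λ(∅, n') ≠ 0`: Zhang Thm. 7.1 = the Skinner–Urban direction for the form raised at the odd
  set `n'`, read through the Gross formula; at `p = 3 ∥ N` the memo brick R-SU3 + B♭) + (A⇐) at `m = ∅`.
At `p = 3` rank lowering (A1) on GOOD levels is a THEOREM: stub A `Method2StubA.stub_levelRaisingAtThree` (koly g13, p489918).

THIS FILE (theorems only):
* §0 `not_mem_baseLocusQ_iff`, `ne_zero_of_not_mem_torsionLocalKer` — bookkeeping.
* §1 `transport_of_reciprocityLaws` — the field `transport` (in the even-bottom-level shape consumed by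
  `nonempty_levelKolyvaginSystem_of_evenLevels`) from (A⇐) at even good levels and (B⇒) at odd good levels.
* §2 `ne_zero_of_anchor_above` (one level of total canonical rank one + (A1) there + the anchor one prime up + (A⇐) for the
  class ⟹ the class is non-zero) and `baseCase_of_oddLevelAnchor` — the field `baseCase` at every even good level.
* §3 `nonempty_levelKolyvaginSystem_of_bipartite` — `Nonempty (LevelKolyvaginSystem W K Dt β ι c)` from ONE displayed mod-3
  bipartite datum {signs `ε₀`, even-level classes `κ₀` with `realisation` at `∅` and the local axioms `sign` ∕ `selmer_off` ∕
  `selmer_inf` ∕ `ordinary_on` ∕ `transverse_on` ∕ `relation` at even good levels, odd-level values `λ`, (A⇐), (B⇒)} + (A1) in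
  binder form + the anchor (γ); and `stub_levelKolyvaginSystemsAtThree_of_bipartite` — the registered S2-KS text's frame
  hypotheses VERBATIM followed by the bipartite binders, concluding `Nonempty (LevelKolyvaginSystem W K Dt β ι c)`, with (A1)
  DISCHARGED by stub A.

KERNEL READING (what S2-KS asks beyond the E-side, in the printed shape): a mod-3 BIPARTITE EULER SYSTEM for `(E, K, 3)` on the
GOOD unipotent-admissible levels extending E's Kolyvagin classes — (R2) level raising at `3 ∥ N` to exact level `N∏n` with
`J(X_n)[𝔪_n] ≃ E[3]` and the classes `c(∏m, ∏n)` of (3.30) with their local conditions (R4: Kummer off `m ∪ n`, ordinary on `n`,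
transverse on `m`, (8.1)); (R6) the two reciprocity halves (A⇐) ∕ (B⇒) through the definite values `λ(m, n')` (Ihara + multiplicity
one at `3`); (R7) the anchor (γ) at the DEFINITE levels only (Zhang Thm. 7.1 at `p = 3`). None of these is asserted here.

HONEST FRAMING: theorems only; 0 definitions, 0 named facts, 0 `sorry`; every bipartite input and the anchor are explicit
HYPOTHESES (binders); closes nothing (T7: the stub S2-KS is NOT proved by this — it is re-expressed). PARTITION: O2@3 (B10) × A1 ×
crux 19574 × stub S2-KS — proves-glue (shape reduction of the residual stub to the printed bipartite shape). BSD is not proved by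
any of this.

References: [cite: WZhang2014, §3.1, §3.9 (3.30), Thm. 4.3 with (4.3)–(4.5) and (4.8), Prop. 5.4, Thm. 7.1, Thm. 7.2 (proof
pp. 232–233), §8.1, Def. 8.3, §9] [cite: BertoliniDarmon2005, Thm. 4.1, Thm. 4.2] [cite: GrossLMS1991, §4 (4.4)].
-/

noncomputable section

open scoped Classical

namespace Summit.BirchSwinnertonDyer.Rank1Residual.X11b.Three.Koly.Method2Bipartite

open WeierstrassCurve NumberField IsDedekindDomain
  Literature.NumberTheory.EllipticCurves Literature.NumberTheory.EllipticCurves.ModularForms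
  Literature.NumberTheory.GaloisRepresentations Module

open Summit.BirchSwinnertonDyer.Rank1Residual.X11b.Three.Koly.Method2

variable (W : WeierstrassCurve ℚ) (K : Type) [Field K] [NumberField K]
  [W.IsGloballyMinimal] [NeZero (W.conductorNorm ℤ)]
  (Dt : ModularParametrizationData W (W.conductorNorm ℤ)) (β : ℤ) (ι : K →+* ℂ) (c : K ≃ₐ[ℚ] K)
  [Module (ZMod 3) (V3 W K)]

/-! ## §0 Bookkeeping -/

omit [NeZero (W.conductorNorm ℤ)] [Module (ZMod 3) (V3 W K)] in
/-- **Off the base locus = some class is detected**: `q ∉ baseLocus(κ, n)` iff some class `κ m n` is NOT locally trivial at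
some place above `q`. [cite: WZhang2014, Def. 8.3] -/
theorem not_mem_baseLocusQ_iff {M : Type} {κ : M → Finset {q // IsUAdmissiblePrime W K q} → V3 W K}
    {n : Finset {q // IsUAdmissiblePrime W K q}} {q : {q // IsUAdmissiblePrime W K q}} :
    q ∉ baseLocusQ W K κ n ↔ ∃ m, ∃ v : HeightOneSpectrum (𝓞 K), ((q : ℕ) : 𝓞 K) ∈ v.asIdeal ∧
      κ m n ∉ (W.baseChange K).torsionLocalKer (v.adicCompletion K) ((3 ^ 1 : ℕ) : ℤ) := by
  simp only [baseLocusQ, Set.mem_setOf_eq, not_forall, exists_prop]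

omit [W.IsGloballyMinimal] [NeZero (W.conductorNorm ℤ)] [Module (ZMod 3) (V3 W K)] in
/-- A class NOT locally trivial at some place is non-zero. [folklore] -/
theorem ne_zero_of_not_mem_torsionLocalKer {x : V3 W K} {v : HeightOneSpectrum (𝓞 K)}
    (h : x ∉ (W.baseChange K).torsionLocalKer (v.adicCompletion K) ((3 ^ 1 : ℕ) : ℤ)) : x ≠ 0 := by
  rintro rfl
  exact h (zero_mem _)

/-! ## §1 `transport` from the two reciprocity laws -/

omit [NeZero (W.conductorNorm ℤ)] [Module (ZMod 3) (V3 W K)] in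
/-- **`transport` FROM THE RECIPROCITY LAWS at `p = 3`** (W. Zhang's proof of Thm. 4.3, on GOOD levels). Let `κ₀(m, n) ∈
H¹(K, E[3])` be classes at the (even) levels and `λ(m, n) ∈ 𝔽₃` values at the (odd) levels, subject to the two ONE-DIRECTIONAL laws
on good levels: (A⇐) for `n ∪ q` good, `n` even, `q ∉ n`: `λ(m, n∪q) ≠ 0 ⟹ κ₀(m, n)` is NOT locally trivial at some place above `q`
(finite part at a NEW unipotent-admissible prime = the value one level up; BD05 Thm. 4.2 ∕ Zhang (4.8)); (B⇒) for `n' ∪ q` good,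
`n'` odd, `q ∉ n'`: `κ₀(m, n'∪q)` NOT locally trivial above `q ⟹ λ(m, n') ≠ 0` (ordinary part at a LEVEL prime = the value one level
down; BD05 Thm. 4.1). Then for good levels `n ⊂ n∪q₁ ⊂ n∪q₁∪q₂` with `n` even: if `q₂` is off the base locus of level `n∪q₁∪q₂`, some
class `κ₀(m, n)` is non-zero — indeed detected above `q₁` ((B⇒) at `n' = n∪q₁`, then (A⇐) at `n`). This is the `transport` binder of
`Method2EvenLevels.nonempty_levelKolyvaginSystem_of_evenLevels`. [cite: WZhang2014, Thm. 4.3, (4.3)–(4.5), (4.8)]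
[cite: BertoliniDarmon2005, Thm. 4.1, Thm. 4.2] -/
theorem transport_of_reciprocityLaws {M : Type} {κ₀ : M → Finset {q // IsUAdmissiblePrime W K q} → V3 W K}
    {lam : M → Finset {q // IsUAdmissiblePrime W K q} → ZMod 3}
    (lawA : ∀ (n : Finset {q // IsUAdmissiblePrime W K q}) (q : {q // IsUAdmissiblePrime W K q}),
      GoodLevel W K (insert q n) → Even n.card → q ∉ n → ∀ m : M,
      lam m (insert q n) ≠ 0 → ∃ v : HeightOneSpectrum (𝓞 K), ((q : ℕ) : 𝓞 K) ∈ v.asIdeal ∧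
        κ₀ m n ∉ (W.baseChange K).torsionLocalKer (v.adicCompletion K) ((3 ^ 1 : ℕ) : ℤ))
    (lawB : ∀ (n : Finset {q // IsUAdmissiblePrime W K q}) (q : {q // IsUAdmissiblePrime W K q}),
      GoodLevel W K (insert q n) → Odd n.card → q ∉ n → ∀ (m : M) (v : HeightOneSpectrum (𝓞 K)),
      ((q : ℕ) : 𝓞 K) ∈ v.asIdeal →
      κ₀ m (insert q n) ∉ (W.baseChange K).torsionLocalKer (v.adicCompletion K) ((3 ^ 1 : ℕ) : ℤ) → lam m n ≠ 0) :
    ∀ (n : Finset {q // IsUAdmissiblePrime W K q}) (q₁ q₂ : {q // IsUAdmissiblePrime W K q}),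
      GoodLevel W K n → GoodLevel W K (insert q₁ n) → GoodLevel W K (insert q₂ (insert q₁ n)) →
      q₁ ∉ n → q₂ ∉ insert q₁ n → Even n.card → q₂ ∉ baseLocusQ W K κ₀ (insert q₂ (insert q₁ n)) → ∃ m, κ₀ m n ≠ 0 := by
  intro n q₁ q₂ _ hn₁ hn₂ hq₁ hq₂ he hbase
  obtain ⟨m, v, hv, hdet⟩ := (not_mem_baseLocusQ_iff W K).mp hbase
  -- (B⇒) at the odd good level `n ∪ q₁`: the value `λ(m, n∪q₁)` is non-zero
  have hlam : lam m (insert q₁ n) ≠ 0 :=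
    lawB (insert q₁ n) q₂ hn₂ (by rw [Finset.card_insert_of_notMem hq₁]; exact he.add_one) hq₂ m v hv hdet
  -- (A⇐) at the even good level `n`: the class `κ₀(m, n)` is detected above `q₁`
  obtain ⟨v₁, -, hdet₁⟩ := lawA n q₁ hn₁ he hq₁ m hlam
  exact ⟨m, ne_zero_of_not_mem_torsionLocalKer W K hdet₁⟩

/-! ## §2 `baseCase` from the rank-0 anchor at odd levels -/

omit [NeZero (W.conductorNorm ℤ)] in
/-- **One good level of rank one, an anchor one prime up, a reading law ⟹ the class is non-zero** (the core of W. Zhang's proof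
of Thm. 7.2, run at `p = 3` on good levels). At a good level `n` with `dim Sel_n⁺ + dim Sel_n⁻ = 1`: IF (A1) every non-zero class
of `Sel_n^μ` is killed in `Sel_{n∪q}^μ` for some NEW unipotent-admissible `q` with `n ∪ q` good, codimension one and the other sign
unchanged, (γ) the value `λ_q` is non-zero whenever the good level `n ∪ q` has total canonical rank zero, and (A⇐) `λ_q ≠ 0` makes
the class `y` NOT locally trivial above `q` — THEN `y ≠ 0`. [cite: WZhang2014, Thm. 7.2 (proof pp. 232–233), Prop. 5.4, Thm. 7.1,
(4.8)] -/
theorem ne_zero_of_anchor_above {y : V3 W K} (n : Finset {q // IsUAdmissiblePrime W K q})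
    {lamq : {q // IsUAdmissiblePrime W K q} → ZMod 3} (hn : GoodLevel W K n)
    (hA1n : ∀ (μ : Bool) (x : V3 W K), GoodLevel W K n → x ∈ SelQ W K c n μ → x ≠ 0 →
      ∃ q : {q // IsUAdmissiblePrime W K q}, q ∉ n ∧ GoodLevel W K (insert q n) ∧
        x ∉ SelQ W K c (insert q n) μ ∧
        SelQ W K c (insert q n) μ ≤ SelQ W K c n μ ∧
        finrank (ZMod 3) (SelQ W K c (insert q n) μ) + 1 = finrank (ZMod 3) (SelQ W K c n μ) ∧
        SelQ W K c (insert q n) (!μ) = SelQ W K c n (!μ))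
    (lawAn : ∀ q : {q // IsUAdmissiblePrime W K q}, GoodLevel W K (insert q n) → q ∉ n → lamq q ≠ 0 →
      ∃ v : HeightOneSpectrum (𝓞 K), ((q : ℕ) : 𝓞 K) ∈ v.asIdeal ∧
        y ∉ (W.baseChange K).torsionLocalKer (v.adicCompletion K) ((3 ^ 1 : ℕ) : ℤ))
    (anchorn : ∀ q : {q // IsUAdmissiblePrime W K q}, GoodLevel W K (insert q n) → q ∉ n →
      finrank (ZMod 3) (SelQ W K c (insert q n) true) + finrank (ZMod 3) (SelQ W K c (insert q n) false) = 0 →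
      lamq q ≠ 0)
    (h1 : finrank (ZMod 3) (SelQ W K c n true) + finrank (ZMod 3) (SelQ W K c n false) = 1) : y ≠ 0 := by
  -- the sign `μ` carrying the rank-one line, the other sign trivial
  obtain ⟨μ, hμ1, hμ0⟩ : ∃ μ : Bool, finrank (ZMod 3) (SelQ W K c n μ) = 1 ∧
      finrank (ZMod 3) (SelQ W K c n (!μ)) = 0 := by
    rcases Nat.eq_zero_or_pos (finrank (ZMod 3) (SelQ W K c n true)) with h | h
    · exact ⟨false, by omega, h⟩
    · exact ⟨true, by omega, by change finrank (ZMod 3) (SelQ W K c n false) = 0; omega⟩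
  -- a non-zero class `x` on the line
  have hne : SelQ W K c n μ ≠ ⊥ := by
    intro h
    rw [h, finrank_bot] at hμ1
    exact zero_ne_one hμ1
  obtain ⟨x, hx, hx0⟩ := Submodule.exists_mem_ne_zero_of_ne_bot hne
  -- (A1): a NEW good unipotent-admissible prime `q` kills the line; the good level `n ∪ q` has total canonical rank zero
  obtain ⟨q, hqn, hgood, -, -, hrank, hother⟩ := hA1n μ x hn hx hx0
  have hzero : finrank (ZMod 3) (SelQ W K c (insert q n) true) +
      finrank (ZMod 3) (SelQ W K c (insert q n) false) = 0 := by
    have hμ' : finrank (ZMod 3) (SelQ W K c (insert q n) μ) = 0 := by omega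
    have hμ'' : finrank (ZMod 3) (SelQ W K c (insert q n) (!μ)) = 0 := by rw [hother]; exact hμ0
    cases μ
    · change finrank (ZMod 3) (SelQ W K c (insert q n) true) = 0 at hμ''
      omega
    · change finrank (ZMod 3) (SelQ W K c (insert q n) false) = 0 at hμ''
      omega
  -- (γ) one prime up, then (A⇐) reads the value on the class
  obtain ⟨v, -, hdet⟩ := lawAn q hgood hqn (anchorn q hgood hqn hzero)
  exact ne_zero_of_not_mem_torsionLocalKer W K hdet

omit [NeZero (W.conductorNorm ℤ)] in
/-- **`baseCase` FROM THE RANK-0 ANCHOR AT ODD GOOD LEVELS** (W. Zhang's proof of Thm. 7.2 run at an arbitrary even good level,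
`p = 3`). Inputs: (A1) rank lowering at one more GOOD unipotent-admissible prime in binder form (the registered text of stub A —
LANDED, `Method2StubA.stub_levelRaisingAtThree`); (A⇐) with `m = ∅` for `n` even and `q ∉ n`, `n ∪ q` good (finite part of the
conductor-one class at a NEW prime ⟸ the value one level up, BD05 Thm. 4.2 ∕ Zhang (4.8)); (γ) the ANCHOR at ODD good levels:
`dim Sel_{n'}⁺ + dim Sel_{n'}⁻ = 0 ⟹ λ(∅, n') ≠ 0` (Zhang Thm. 7.1 for the form raised at the odd set `n'`, with the Gross formula).
Output: at EVERY even good level `n` (also `n = ∅`) of total canonical rank one, `κ₀(∅, n) ≠ 0` — the structure's field `baseCase`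
(which asks it at non-empty even good levels). [cite: WZhang2014, Thm. 7.2 (proof), Thm. 7.1, Prop. 5.4, (4.8)] -/
theorem baseCase_of_oddLevelAnchor
    {κ₀ : Finset {ℓ // Zhang2014.IsKolyvaginPrime (W.conductorNorm ℤ) W K 3 ℓ} →
      Finset {q // IsUAdmissiblePrime W K q} → V3 W K}
    {lam : Finset {ℓ // Zhang2014.IsKolyvaginPrime (W.conductorNorm ℤ) W K 3 ℓ} →
      Finset {q // IsUAdmissiblePrime W K q} → ZMod 3}
    (hA1 : ∀ (n : Finset {q // IsUAdmissiblePrime W K q}) (μ : Bool) (x : V3 W K),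
      GoodLevel W K n → x ∈ SelQ W K c n μ → x ≠ 0 →
      ∃ q : {q // IsUAdmissiblePrime W K q}, q ∉ n ∧ GoodLevel W K (insert q n) ∧
        x ∉ SelQ W K c (insert q n) μ ∧
        SelQ W K c (insert q n) μ ≤ SelQ W K c n μ ∧
        finrank (ZMod 3) (SelQ W K c (insert q n) μ) + 1 = finrank (ZMod 3) (SelQ W K c n μ) ∧
        SelQ W K c (insert q n) (!μ) = SelQ W K c n (!μ))
    (lawA : ∀ (n : Finset {q // IsUAdmissiblePrime W K q}) (q : {q // IsUAdmissiblePrime W K q}),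
      GoodLevel W K (insert q n) → Even n.card → q ∉ n →
      ∀ m : Finset {ℓ // Zhang2014.IsKolyvaginPrime (W.conductorNorm ℤ) W K 3 ℓ},
      lam m (insert q n) ≠ 0 → ∃ v : HeightOneSpectrum (𝓞 K), ((q : ℕ) : 𝓞 K) ∈ v.asIdeal ∧
        κ₀ m n ∉ (W.baseChange K).torsionLocalKer (v.adicCompletion K) ((3 ^ 1 : ℕ) : ℤ))
    (anchor : ∀ n : Finset {q // IsUAdmissiblePrime W K q}, GoodLevel W K n → Odd n.card →
      finrank (ZMod 3) (SelQ W K c n true) + finrank (ZMod 3) (SelQ W K c n false) = 0 → lam ∅ n ≠ 0) :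
    ∀ n : Finset {q // IsUAdmissiblePrime W K q}, GoodLevel W K n → Even n.card →
      finrank (ZMod 3) (SelQ W K c n true) + finrank (ZMod 3) (SelQ W K c n false) = 1 → κ₀ ∅ n ≠ 0 :=
  fun n hn he h1 ↦ ne_zero_of_anchor_above W K c n (lamq := fun q ↦ lam ∅ (insert q n)) hn
    (fun μ x hn' hx hx0 ↦ hA1 n μ x hn' hx hx0)
    (fun q hgood hqn hlam ↦ lawA n q hgood he hqn ∅ hlam)
    (fun q hgood hqn h0 ↦ anchor (insert q n) hgood (by rw [Finset.card_insert_of_notMem hqn]; exact he.add_one) h0)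
    h1

/-! ## §3 Assembly: a level Kolyvagin system at `p = 3` from a bipartite datum -/

/-- **THE BIPARTITE DICTIONARY AT `p = 3` (abstract form).** A `Method2.LevelKolyvaginSystem W K Dt β ι c` EXISTS as soon as one
has: classes `κ₀(m, n) ∈ H¹(K, E[3])` owed at the EVEN good levels only (`realisation` at `∅`; `sign` ∕ Kummer off the support ∕
ordinary on the level ∕ transverse on the conductor ∕ (8.1), each at even good non-empty levels — the structure's field texts with
the guard `Even n.card →`), values `λ(m, n) ∈ 𝔽₃` at the ODD good levels, the reciprocity halves (A⇐) and (B⇒) on good levels, rank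
lowering (A1) on good levels in binder form (stub A's registered text), and the rank-0 ANCHOR (γ) at odd good levels
`dim Sel_{n'}⁺ + dim Sel_{n'}⁻ = 0 ⟹ λ(∅, n') ≠ 0` (`transport` by §1, `baseCase` by §2, odd levels filled with `0` by koly g16's
`Method2EvenLevels.nonempty_levelKolyvaginSystem_of_evenLevels`). [cite: WZhang2014, §3, Thm. 4.3, Thm. 7.1, Thm. 7.2, §8.1, §9]
[cite: BertoliniDarmon2005, Thm. 4.1, Thm. 4.2] -/
theorem nonempty_levelKolyvaginSystem_of_bipartite
    (ε₀ : Finset {q // IsUAdmissiblePrime W K q} → Bool)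
    (κ₀ : Finset {ℓ // Zhang2014.IsKolyvaginPrime (W.conductorNorm ℤ) W K 3 ℓ} →
      Finset {q // IsUAdmissiblePrime W K q} → V3 W K)
    (lam : Finset {ℓ // Zhang2014.IsKolyvaginPrime (W.conductorNorm ℤ) W K 3 ℓ} →
      Finset {q // IsUAdmissiblePrime W K q} → ZMod 3)
    (realisation : ∀ m : Finset {ℓ // Zhang2014.IsKolyvaginPrime (W.conductorNorm ℤ) W K 3 ℓ},
      ∃ d : KolyvaginHeegnerData Dt β ι (∏ ℓ ∈ m, (ℓ : ℕ)), κ₀ m ∅ = d.kolyvaginClass Nat.prime_three 1)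
    (sign : ∀ n, GoodLevel W K n → n.Nonempty → Even n.card →
      ∀ m : Finset {ℓ // Zhang2014.IsKolyvaginPrime (W.conductorNorm ℤ) W K 3 ℓ},
      conjAct W c ((3 ^ 1 : ℕ) : ℤ) (κ₀ m n) = sgn (ε₀ n ^^ Nat.bodd m.card) • κ₀ m n)
    (selmer_off : ∀ n, GoodLevel W K n → n.Nonempty → Even n.card →
      ∀ (m : Finset {ℓ // Zhang2014.IsKolyvaginPrime (W.conductorNorm ℤ) W K 3 ℓ}) (v : HeightOneSpectrum (𝓞 K)),
      (∀ ℓ ∈ m, ((ℓ : ℕ) : 𝓞 K) ∉ v.asIdeal) → (∀ q ∈ n, ((q : ℕ) : 𝓞 K) ∉ v.asIdeal) →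
      κ₀ m n ∈ selmerLocalKer (W.baseChange K) (v.adicCompletion K) ((3 ^ 1 : ℕ) : ℤ))
    (selmer_inf : ∀ n, GoodLevel W K n → n.Nonempty → Even n.card →
      ∀ (m : Finset {ℓ // Zhang2014.IsKolyvaginPrime (W.conductorNorm ℤ) W K 3 ℓ}) (w : InfinitePlace K),
      κ₀ m n ∈ selmerLocalKer (W.baseChange K) w.Completion ((3 ^ 1 : ℕ) : ℤ))
    (ordinary_on : ∀ n, GoodLevel W K n → n.Nonempty → Even n.card →
      ∀ m : Finset {ℓ // Zhang2014.IsKolyvaginPrime (W.conductorNorm ℤ) W K 3 ℓ}, ∀ q ∈ n, ∀ v : HeightOneSpectrum (𝓞 K),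
      ((q : ℕ) : 𝓞 K) ∈ v.asIdeal → κ₀ m n ∈ (W.baseChange K).ordinaryLocalKer (v.adicCompletion K) ((3 ^ 1 : ℕ) : ℤ))
    (transverse_on : ∀ n, GoodLevel W K n → n.Nonempty → Even n.card →
      ∀ m : Finset {ℓ // Zhang2014.IsKolyvaginPrime (W.conductorNorm ℤ) W K 3 ℓ}, ∀ ℓ ∈ m, ∀ v : HeightOneSpectrum (𝓞 K),
      ((ℓ : ℕ) : 𝓞 K) ∈ v.asIdeal → κ₀ m n ∈ transverseLocalKer W K ι ℓ v)
    (relation : ∀ n, GoodLevel W K n → n.Nonempty → Even n.card →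
      ∀ (m : Finset {ℓ // Zhang2014.IsKolyvaginPrime (W.conductorNorm ℤ) W K 3 ℓ})
        (ℓ : {ℓ // Zhang2014.IsKolyvaginPrime (W.conductorNorm ℤ) W K 3 ℓ}), ℓ ∉ m → ∀ v : HeightOneSpectrum (𝓞 K),
      ((ℓ : ℕ) : 𝓞 K) ∈ v.asIdeal →
      (κ₀ (insert ℓ m) n ∈ (W.baseChange K).torsionLocalKer (v.adicCompletion K) ((3 ^ 1 : ℕ) : ℤ) ↔
        κ₀ m n ∈ (W.baseChange K).torsionLocalKer (v.adicCompletion K) ((3 ^ 1 : ℕ) : ℤ)))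
    (lawA : ∀ (n : Finset {q // IsUAdmissiblePrime W K q}) (q : {q // IsUAdmissiblePrime W K q}),
      GoodLevel W K (insert q n) → Even n.card → q ∉ n →
      ∀ m : Finset {ℓ // Zhang2014.IsKolyvaginPrime (W.conductorNorm ℤ) W K 3 ℓ},
      lam m (insert q n) ≠ 0 → ∃ v : HeightOneSpectrum (𝓞 K), ((q : ℕ) : 𝓞 K) ∈ v.asIdeal ∧
        κ₀ m n ∉ (W.baseChange K).torsionLocalKer (v.adicCompletion K) ((3 ^ 1 : ℕ) : ℤ))
    (lawB : ∀ (n : Finset {q // IsUAdmissiblePrime W K q}) (q : {q // IsUAdmissiblePrime W K q}),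
      GoodLevel W K (insert q n) → Odd n.card → q ∉ n →
      ∀ (m : Finset {ℓ // Zhang2014.IsKolyvaginPrime (W.conductorNorm ℤ) W K 3 ℓ}) (v : HeightOneSpectrum (𝓞 K)),
      ((q : ℕ) : 𝓞 K) ∈ v.asIdeal →
      κ₀ m (insert q n) ∉ (W.baseChange K).torsionLocalKer (v.adicCompletion K) ((3 ^ 1 : ℕ) : ℤ) → lam m n ≠ 0)
    (hA1 : ∀ (n : Finset {q // IsUAdmissiblePrime W K q}) (μ : Bool) (x : V3 W K),
      GoodLevel W K n → x ∈ SelQ W K c n μ → x ≠ 0 →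
      ∃ q : {q // IsUAdmissiblePrime W K q}, q ∉ n ∧ GoodLevel W K (insert q n) ∧
        x ∉ SelQ W K c (insert q n) μ ∧
        SelQ W K c (insert q n) μ ≤ SelQ W K c n μ ∧
        finrank (ZMod 3) (SelQ W K c (insert q n) μ) + 1 = finrank (ZMod 3) (SelQ W K c n μ) ∧
        SelQ W K c (insert q n) (!μ) = SelQ W K c n (!μ))
    (anchor : ∀ n : Finset {q // IsUAdmissiblePrime W K q}, GoodLevel W K n → Odd n.card →
      finrank (ZMod 3) (SelQ W K c n true) + finrank (ZMod 3) (SelQ W K c n false) = 0 → lam ∅ n ≠ 0) :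
    Nonempty (LevelKolyvaginSystem W K Dt β ι c) :=
  Method2EvenLevels.nonempty_levelKolyvaginSystem_of_evenLevels W K Dt β ι c ε₀ κ₀ realisation sign selmer_off
    selmer_inf ordinary_on transverse_on relation (transport_of_reciprocityLaws W K lawA lawB)
    (fun n hn _ he h1 ↦ baseCase_of_oddLevelAnchor W K c hA1 lawA anchor n hn he h1)

/-- **THE BIPARTITE DICTIONARY AT A HOFFSTEIN–LUO A1 FRAME: stub S2-KS's text from a bipartite datum, (A1) DISCHARGED.** The
registered hypotheses of `stub_levelKolyvaginSystemsAtThree` VERBATIM (E ∈ ClassX11b@3 with multiplicative reduction at `3`,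
`ρ̄_{E,3}` onto, a (ram) witness, `3 ∤ ∏c_ℓ`; `K` imaginary quadratic Heegner for `N`, `d_K` odd, `L(E^{d_K}, 1) ≠ 0`, `d_K ≠ −3`;
a conductor-1 frame `(Dt, β, ι)` with `4N ∣ β² − d_K` and Manin constant prime to `3`; complex conjugation `c ≠ 1`; the
`ZMod 3`-structure of `H¹(K, E[3])`), followed by ONE mod-3 bipartite datum on the good unipotent-admissible levels — even-level
classes `κ₀` (realisation at `∅` + the six local axioms at even good levels), odd-level values `λ`, the laws (A⇐) ∕ (B⇒), the rank-0
ANCHOR (γ) at odd good levels — give `Nonempty (LevelKolyvaginSystem W K Dt β ι c)`; rank lowering (A1) is DISCHARGED by the landed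
stub A `Method2StubA.stub_levelRaisingAtThree` (p489918). What S2-KS asks beyond the E-side is thus exactly, in the printed shape:
the mod-3 bipartite system on good levels (level raising at `3 ∥ N` + the (3.30) classes with their local conditions + the two BD
reciprocity halves through the definite values) and the anchor (γ) at the DEFINITE levels (Zhang Thm. 7.1 at `p = 3`).
[cite: WZhang2014, §3, Thm. 4.3, Prop. 5.4, Thm. 7.1, Thm. 7.2, §9] [cite: BertoliniDarmon2005, Thm. 4.1, Thm. 4.2] -/
theorem stub_levelKolyvaginSystemsAtThree_of_bipartite :
    ∀ (W : WeierstrassCurve ℚ) [W.IsElliptic] [W.IsGloballyMinimal] [NeZero (W.conductorNorm ℤ)] (K : Type)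
      [Field K] [NumberField K] (Dt : ModularParametrizationData W (W.conductorNorm ℤ)) (β : ℤ) (ι : K →+* ℂ),
      Summit.BirchSwinnertonDyer.Rank1Residual.ClassX11b W 3 → W.HasMultiplicativeReductionAtPrime 3 →
      Rank1Residual.Surj W 3 → Rank1Residual.Ram W 3 → ¬ 3 ∣ W.tamagawaProduct → IsImaginaryQuadratic K →
      Odd (NumberField.discr K) → SatisfiesHeegnerHypothesis (W.conductorNorm ℤ) K →
      (W.quadraticTwist (NumberField.discr K : ℚ)).entireLFunction 1 ≠ 0 → NumberField.discr K ≠ -3 →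
      (4 * (W.conductorNorm ℤ : ℤ)) ∣ β ^ 2 - NumberField.discr K → ¬ (3 : ℤ) ∣ Dt.c →
      ∀ (c : K ≃ₐ[ℚ] K), c ≠ 1 → ∀ [Module (ZMod 3) (V3 W K)],
      -- THE BIPARTITE DATUM on good unipotent-admissible levels
      ∀ (ε₀ : Finset {q // IsUAdmissiblePrime W K q} → Bool)
        (κ₀ : Finset {ℓ // Zhang2014.IsKolyvaginPrime (W.conductorNorm ℤ) W K 3 ℓ} →
          Finset {q // IsUAdmissiblePrime W K q} → V3 W K)
        (lam : Finset {ℓ // Zhang2014.IsKolyvaginPrime (W.conductorNorm ℤ) W K 3 ℓ} →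
          Finset {q // IsUAdmissiblePrime W K q} → ZMod 3),
      -- realisation at `∅`: the frame's Kolyvagin classes mod 3
      (∀ m : Finset {ℓ // Zhang2014.IsKolyvaginPrime (W.conductorNorm ℤ) W K 3 ℓ},
        ∃ d : KolyvaginHeegnerData Dt β ι (∏ ℓ ∈ m, (ℓ : ℕ)), κ₀ m ∅ = d.kolyvaginClass Nat.prime_three 1) →
      -- the six local axioms at even good non-empty levels
      (∀ n, GoodLevel W K n → n.Nonempty → Even n.card →
        ∀ m : Finset {ℓ // Zhang2014.IsKolyvaginPrime (W.conductorNorm ℤ) W K 3 ℓ},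
        conjAct W c ((3 ^ 1 : ℕ) : ℤ) (κ₀ m n) = sgn (ε₀ n ^^ Nat.bodd m.card) • κ₀ m n) →
      (∀ n, GoodLevel W K n → n.Nonempty → Even n.card →
        ∀ (m : Finset {ℓ // Zhang2014.IsKolyvaginPrime (W.conductorNorm ℤ) W K 3 ℓ}) (v : HeightOneSpectrum (𝓞 K)),
        (∀ ℓ ∈ m, ((ℓ : ℕ) : 𝓞 K) ∉ v.asIdeal) → (∀ q ∈ n, ((q : ℕ) : 𝓞 K) ∉ v.asIdeal) →
        κ₀ m n ∈ selmerLocalKer (W.baseChange K) (v.adicCompletion K) ((3 ^ 1 : ℕ) : ℤ)) →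
      (∀ n, GoodLevel W K n → n.Nonempty → Even n.card →
        ∀ (m : Finset {ℓ // Zhang2014.IsKolyvaginPrime (W.conductorNorm ℤ) W K 3 ℓ}) (w : InfinitePlace K),
        κ₀ m n ∈ selmerLocalKer (W.baseChange K) w.Completion ((3 ^ 1 : ℕ) : ℤ)) →
      (∀ n, GoodLevel W K n → n.Nonempty → Even n.card →
        ∀ m : Finset {ℓ // Zhang2014.IsKolyvaginPrime (W.conductorNorm ℤ) W K 3 ℓ}, ∀ q ∈ n,
        ∀ v : HeightOneSpectrum (𝓞 K), ((q : ℕ) : 𝓞 K) ∈ v.asIdeal →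
        κ₀ m n ∈ (W.baseChange K).ordinaryLocalKer (v.adicCompletion K) ((3 ^ 1 : ℕ) : ℤ)) →
      (∀ n, GoodLevel W K n → n.Nonempty → Even n.card →
        ∀ m : Finset {ℓ // Zhang2014.IsKolyvaginPrime (W.conductorNorm ℤ) W K 3 ℓ}, ∀ ℓ ∈ m,
        ∀ v : HeightOneSpectrum (𝓞 K), ((ℓ : ℕ) : 𝓞 K) ∈ v.asIdeal → κ₀ m n ∈ transverseLocalKer W K ι ℓ v) →
      (∀ n, GoodLevel W K n → n.Nonempty → Even n.card →
        ∀ (m : Finset {ℓ // Zhang2014.IsKolyvaginPrime (W.conductorNorm ℤ) W K 3 ℓ})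
          (ℓ : {ℓ // Zhang2014.IsKolyvaginPrime (W.conductorNorm ℤ) W K 3 ℓ}), ℓ ∉ m → ∀ v : HeightOneSpectrum (𝓞 K),
        ((ℓ : ℕ) : 𝓞 K) ∈ v.asIdeal →
        (κ₀ (insert ℓ m) n ∈ (W.baseChange K).torsionLocalKer (v.adicCompletion K) ((3 ^ 1 : ℕ) : ℤ) ↔
          κ₀ m n ∈ (W.baseChange K).torsionLocalKer (v.adicCompletion K) ((3 ^ 1 : ℕ) : ℤ))) →
      -- (A⇐): finite part at a NEW prime ⟸ the value one level up (BD05 Thm. 4.2 ∕ Zhang (4.8))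
      (∀ (n : Finset {q // IsUAdmissiblePrime W K q}) (q : {q // IsUAdmissiblePrime W K q}),
        GoodLevel W K (insert q n) → Even n.card → q ∉ n →
        ∀ m : Finset {ℓ // Zhang2014.IsKolyvaginPrime (W.conductorNorm ℤ) W K 3 ℓ},
        lam m (insert q n) ≠ 0 → ∃ v : HeightOneSpectrum (𝓞 K), ((q : ℕ) : 𝓞 K) ∈ v.asIdeal ∧
          κ₀ m n ∉ (W.baseChange K).torsionLocalKer (v.adicCompletion K) ((3 ^ 1 : ℕ) : ℤ)) →
      -- (B⇒): ordinary part at a LEVEL prime ⟹ the value one level down (BD05 Thm. 4.1)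
      (∀ (n : Finset {q // IsUAdmissiblePrime W K q}) (q : {q // IsUAdmissiblePrime W K q}),
        GoodLevel W K (insert q n) → Odd n.card → q ∉ n →
        ∀ (m : Finset {ℓ // Zhang2014.IsKolyvaginPrime (W.conductorNorm ℤ) W K 3 ℓ}) (v : HeightOneSpectrum (𝓞 K)),
        ((q : ℕ) : 𝓞 K) ∈ v.asIdeal →
        κ₀ m (insert q n) ∉ (W.baseChange K).torsionLocalKer (v.adicCompletion K) ((3 ^ 1 : ℕ) : ℤ) →
        lam m n ≠ 0) →
      -- (γ): the rank-0 ANCHOR at odd good levels (Zhang Thm. 7.1 at `p = 3`)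
      (∀ n : Finset {q // IsUAdmissiblePrime W K q}, GoodLevel W K n → Odd n.card →
        finrank (ZMod 3) (SelQ W K c n true) + finrank (ZMod 3) (SelQ W K c n false) = 0 → lam ∅ n ≠ 0) →
      Nonempty (LevelKolyvaginSystem W K Dt β ι c) := by
  intro W _ _ _ K _ _ Dt β ι hX hmult hsurj hram htam hK hodd hH hLt h3 hβ hc c hc1 _ ε₀ κ₀ lam realisation sign
    selmer_off selmer_inf ordinary_on transverse_on relation lawA lawB anchor
  exact nonempty_levelKolyvaginSystem_of_bipartite W K Dt β ι c ε₀ κ₀ lam realisation sign selmer_off selmer_inf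
    ordinary_on transverse_on relation lawA lawB
    (Method2StubA.stub_levelRaisingAtThree W K Dt β ι hX hmult hsurj hram htam hK hodd hH hLt h3 hβ hc c hc1) anchor

end Summit.BirchSwinnertonDyer.Rank1Residual.X11b.Three.Koly.Method2Bipartite

end
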